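import Mathlib.Analysis.Calculus.Deriv.Star
import Mathlib.Analysis.Complex.BranchLogRoot
import Literature.Topology.PlaneTopology.Janiszewski
import Literature.Probability.RandomPlanarGeometry.RestrictionMeasures
import Literature.Probability.RandomPlanarGeometry.HalfPlaneFillProofs
import HarnessLib

/-!
# Smooth hulls, outer approximation and the `±`-factorisation ([LSW] §2)

Half-plane vocabulary of §2 of

* G. F. Lawler, O. Schramm, W. Werner, *Conformal restriction: the chordal case*, J. Amer.
  Math. Soc. **16** (2003) 917–955, arXiv:math/0209343 (**[LSW]**; arXiv page numbers),

needed to upgrade the restriction property of a chordal curve family over JORDAN hull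
subdomains (`ChordalFamily.IsHullRestriction`, `ConformalRestrictionProofs`) to [LSW]'s
`𝒜₁`-covariance for ALL `*`-hulls (`RestrictionConfig.IsHullMultiplicative`,
`RestrictionMeasures`), which is hypothesis (1) of [LSW] Prop. 3.3: only the hulls `A` whose
complement `ℍ ∖ A` is a Jordan domain of the sphere correspond to Jordan subdomains, and the
general `*`-hull is reached by approximation.

1. `Literature.IsArcHull A` — the **smooth hulls** of [LSW] §2 p. 8 ("`A ∈ 𝒬` is a smooth hull if there
   is a smooth curve `γ : [0,1] → ℍ̄` with `γ(0), γ(1) ∈ ℝ`, `γ(0,1) ⊂ ℍ`, `γ(0,1)` has no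
   self-intersections, and `ℍ ∩ ∂A = γ(0,1)`"), with smoothness of `γ` relaxed to continuity
   (a weakening: only the topology of the arc is ever used) and `γ` injective on all of `[0, 1]`
   (a strengthening: the two real endpoints are distinct, as for the hulls `E_δ` below).
2. NAMED FACT `Literature.Probability.RandomPlanarGeometry.IsPlusHull.exists_antitone_isArcHull` — [LSW] Lemma 2.1 (p. 8) for nonempty
   `A ∈ 𝒬₊`, read through its use in the proof of Lemma 3.5 (p. 13): the smooth hulls `E_δ ∈ 𝒬₊`
   decrease to the REAL FILLING `A' = A ∪ [x₀, x₁]` (`x₀ = inf (A ∩ ℝ)`, `x₁ = sup (A ∩ ℝ)`;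
   `Literature.Probability.RandomPlanarGeometry.realFill`; the printed "`A = ⋂ₙ A_n`" holds exactly when `A ∩ ℝ` is an interval, smooth
   hulls being connected), `Φ'_{A_n}(0) ↑ Φ'_A(0)`, and `Φ_{A_n} → Φ_A` uniformly on compact
   subsets of `ℍ̄ ∖ A'` (the convergence notion of Lemma 3.5, p. 12).
3. (non-vacuity) `Literature.Probability.RandomPlanarGeometry.isArcHull_upperHalfDisc`: the closed upper half-disc
   `{|z - 2| ≤ 1, Im z ≥ 0}` is a smooth `+`-hull (PROVED).
4. NAMED FACT `Literature.Probability.RandomPlanarGeometry.IsStarHull.exists_isHullProduct_plus_minus` — [LSW] §2 p. 8: "If `A ∈ 𝒬*`,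
   then we can find unique `A₁, A₃ ∈ 𝒬₊` and `A₂, A₄ ∈ 𝒬₋` such that `A = A₁ · A₂ = A₄ · A₃`"
   (existence of `A = A₁ · A₂`).
5. PROVED: `Literature.Probability.RandomPlanarGeometry.IsBoundedHull.isConnected_union_im_nonpos` — a bounded hull has no part
   floating in `ℍ`: `A ∪ {Im ≤ 0}` is connected (a clopen piece `Y ⊆ ℍ` of `A` would be
   encircled inside the simply connected `ℍ ∖ A`, where `(z - y₀)/(z - y')` has a continuous
   logarithm by Mathlib's `Complex.exists_continuousOn_eqOn_exp_comp`, contradicting Borsuk's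
   criterion `Janiszewski.not_exists_log_of_isBounded` of the tree); and the reflection
   `σ(z) = -z̄` (`Literature.Probability.RandomPlanarGeometry.imagAxisRefl`, [LSW] §2 p. 8 "`σ` the orthogonal reflection about the
   imaginary axis, `𝒬₋ = {σ(A) : A ∈ 𝒬₊}`") with `IsBoundedHull`/`IsStarHull`/`IsArcHull`
   invariance, `IsPlusHull (σ A) ↔ IsMinusHull A`, the conjugate `σ ∘ Φ ∘ σ` of a conformal
   map (`ConformalEquiv.reflect`, a restriction map of `σ(A)`), giving the `𝒬₋` form of
   Lemma 2.1 by symmetry and the packaged outer approximation with convergence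
   `Literature.Probability.RandomPlanarGeometry.HasArcApprox` for nonempty `A ∈ 𝒬₊ ∪ 𝒬₋` (`hasArcApprox_of_plus_or_minus`).
-/

noncomputable section

open Set Filter Topology Metric Bornology Complex
open UpperHalfPlane (upperHalfPlaneSet isOpen_upperHalfPlaneSet)
open scoped ComplexConjugate

namespace Literature.Probability.RandomPlanarGeometry

/-! ### Smooth hulls -/

/-- **Smooth hull** ([LSW] §2 p. 8: "We will call `A ∈ 𝒬` a smooth hull if there is a smooth
curve `γ : [0,1] → ℍ̄` with `γ(0), γ(1) ∈ ℝ`, `γ(0,1) ⊂ ℍ`, `γ(0,1)` has no self-intersections,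
and `ℍ ∩ ∂A = γ(0,1)`"), with two deviations from the printed definition. (i) A WEAKENING: the
curve `γ` is only required to be continuous, not smooth — every use below is topological.
(ii) A STRENGTHENING: `γ` is required to be injective on the CLOSED interval `[0, 1]`, i.e.
additionally `γ(0) ≠ γ(1)`, which narrows the class (a hull bounded by a curve pinched at
`γ(0) = γ(1)` is a smooth hull as printed but not an `IsArcHull`); this makes `ℍ ∖ A` a Jordan
domain of the sphere, and it is justified for the smooth hulls [LSW] actually produce, the
hulls `E_δ` of the proof of Lemma 3.5 (p. 13: "`∂E_δ ∩ ℍ̄` is a simple path `β : [0, s] → ℍ̄` with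
`β(0), β(s) ∈ ℝ`", the endpoints `Φ_A⁻¹(Φ_A(x₀) - δ) < Φ_A⁻¹(Φ_A(x₁) + δ)` being distinct), which
realise Lemma 2.1; accordingly the Lemma 2.1 fact below CONCLUDES this stronger property and
`RestrictionConfig.IsArcHullMultiplicative` only ASKS multiplicativity over this narrower class.
So: `A ∈ 𝒬` and the part of `∂A` in `ℍ` is the interior `γ(0,1) ⊆ ℍ` of a Jordan arc `γ[0,1]`
with distinct real endpoints. [cite: LawlerSchrammWerner2003Restriction, §2 p. 8 (Smooth hulls)] -/
def IsArcHull (A : Set ℂ) : Prop :=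
  IsBoundedHull A ∧ ∃ γ : ℝ → ℂ, ContinuousOn γ (Icc 0 1) ∧ InjOn γ (Icc 0 1) ∧
    (γ 0).im = 0 ∧ (γ 1).im = 0 ∧ (∀ t ∈ Ioo (0 : ℝ) 1, 0 < (γ t).im) ∧
    upperHalfPlaneSet ∩ frontier A = γ '' Ioo 0 1

/-- A smooth hull is a bounded hull. [folklore] -/
theorem IsArcHull.isBoundedHull {A : Set ℂ} (h : IsArcHull A) : IsBoundedHull A :=
  h.1

/-! ### The real trace and the real filling of a hull -/

/-- The real trace `A ∩ ℝ` of `A ⊆ ℂ`, as a set of reals. [folklore] -/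
def realTrace (A : Set ℂ) : Set ℝ := {x : ℝ | (x : ℂ) ∈ A}

/-- **The real filling `A' = A ∪ [x₀, x₁]`** of `A`, `x₀ = inf (A ∩ ℝ)`, `x₁ = sup (A ∩ ℝ)`
([LSW] proof of Lemma 3.5, p. 13, verbatim: "Set `A' := A ∪ [x₀, x₁]`, where `x₀ := inf (A ∩ ℝ)`
and `x₁ := sup (A ∩ ℝ)`"): `A` with its real gaps filled in; for `A ∈ 𝒬₊` it is the decreasing
intersection of the smooth hulls `E_δ` of that proof. [cite: LawlerSchrammWerner2003Restriction, proof of Lemma 3.5 (p. 13, the set A')] -/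
def realFill (A : Set ℂ) : Set ℂ :=
  A ∪ (fun x : ℝ ↦ (x : ℂ)) '' Icc (sInf (realTrace A)) (sSup (realTrace A))

/-- Unfolding `realTrace`. [folklore] -/
theorem mem_realTrace {A : Set ℂ} {x : ℝ} : x ∈ realTrace A ↔ (x : ℂ) ∈ A := Iff.rfl

/-- `A ⊆ A'`. [folklore] -/
theorem subset_realFill (A : Set ℂ) : A ⊆ realFill A := subset_union_left

/-- The real filling adds only real points: `A' ∩ ℍ ⊆ A`. [folklore] -/
theorem realFill_inter_upperHalfPlaneSet_subset (A : Set ℂ) :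
    realFill A ∩ upperHalfPlaneSet ⊆ A := by
  rintro z ⟨hz | ⟨x, -, rfl⟩, hzH⟩
  · exact hz
  · exact absurd hzH (by simp [upperHalfPlaneSet])

/-- The real trace of a compact set is compact. [folklore] -/
theorem isCompact_realTrace {A : Set ℂ} (hA : IsCompact A) : IsCompact (realTrace A) := by
  refine Metric.isCompact_of_isClosed_isBounded (hA.isClosed.preimage continuous_ofReal) ?_
  obtain ⟨R, hR⟩ := hA.isBounded.subset_closedBall 0
  refine isBounded_iff_forall_norm_le.2 ⟨R, fun x hx ↦ ?_⟩
  have := hR hx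
  rwa [mem_closedBall, dist_zero_right, norm_real] at this

/-! ### [LSW] Lemma 2.1, with the convergence of the restriction maps -/

/-- NAMED FACT — **[LSW] Lemma 2.1** (p. 8), verbatim: "Suppose `A ∈ 𝒬₊`. Then there exists a
decreasing sequence of smooth hulls `(A_n)_{n ≥ 1}` such that `A = ⋂_{n=1}^∞ A_n` and the
increasing sequence `Φ'_{A_n}(0)` converges to `Φ'_A(0)`", **together with the convergence
`A_n → A` in the topology of [LSW] Lemma 3.5** (p. 12, verbatim: "we say that `A_n ∈ 𝒬₊`
converges to `A ∈ 𝒬₊` if `Φ_{A_n}` converges to `Φ_A` uniformly on compact subsets of `ℍ̄ ∖ A`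
and `⋃ₙ A_n` is bounded away from `0` and `∞`"), which [LSW] assert for the hulls realising
Lemma 2.1 in the proof of Lemma 3.5 (p. 13, verbatim): "let `D_δ` be the set of points in `ℍ`
with distance at most `δ` from `[Φ_A(x₀), Φ_A(x₁)]`. Let `E_δ` denote the closure of
`A ∪ Φ_A⁻¹(D_δ)`. It is clear that `E_δ → A` as `δ → 0+` in the topology considered above. …
Note that `∂E_δ ∩ ℍ̄` is a simple path, say `β : [0,s] → ℍ̄` with `β(0), β(s) ∈ ℝ`" — these
`E_δ ∈ 𝒬₊` (`δ < Φ_A(x₀)/2`) are smooth hulls in the sense of `IsArcHull` (their boundary in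
`ℍ̄` is the simple path `β = Φ_A⁻¹(∂D_δ ∩ ℍ̄)` with the two DISTINCT real endpoints
`Φ_A⁻¹(Φ_A(x₀) - δ) < Φ_A⁻¹(Φ_A(x₁) + δ)`), and `A_n := E_{δ_n}`, `δ_n ↓ 0`, realises Lemma 2.1
(this is the construction "by considering the image under `Φ_A⁻¹` of appropriately chosen
paths" of its proof, p. 8). Here `x₀, x₁` are introduced one sentence earlier (p. 13, verbatim):
"Let `A ∈ 𝒬₊`. Set `A' := A ∪ [x₀, x₁]`, where `x₀ := inf (A ∩ ℝ)` and `x₁ := sup (A ∩ ℝ)`."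

Reading conventions. (1) THE INTERSECTION IS THE REAL FILLING `A'`, NOT `A`: the hulls `E_δ`
decrease to `⋂_δ E_δ = A ∪ [x₀, x₁] = A'` (`Literature.realFill A`), which equals `A` exactly when
`A ∩ ℝ` is an interval; the printed "`A = ⋂ₙ A_n`" cannot hold otherwise, smooth hulls being
connected (so that a decreasing intersection of them is a continuum) while `+`-hulls need not be
(two disjoint half-discs). Since `ℍ ∖ A' = ℍ ∖ A`, `Φ_{A'} = Φ_A` and nothing else changes; for
the configurations `K` of [LSW] §3 (`K ∩ ℝ = {0}`), `K ∩ A' = ∅ ↔ K ∩ A = ∅`. (2) `A` is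
assumed NONEMPTY (tacit in [LSW]; then `A ∩ ℝ ≠ ∅` by `IsBoundedHull.isConnected_union_im_nonpos`,
so `0 < x₀ ≤ x₁` are genuine). (3) The `A_n` are in `𝒬₊` ("any smooth hull in `𝒬*` is in
`𝒬₊ ∪ 𝒬₋`", §2 p. 8, and `A_n ⊇ A ≠ ∅`). (4) `Φ_A`, `Φ_{A_n}` are any restriction maps
(`IsRestrictionMap`; unique on their domains) and `Φ'(0)` is in the sense of
`HasRestrictionDeriv`. (5) "Uniformly on compact subsets of `ℍ̄ ∖ A`" is read with `A'` for `A`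
(at a real gap point `x ∈ [x₀, x₁] ∖ A` no `Φ_{A_n}` is defined) and stated for the parts in `ℍ`
of such compacts, where the maps live: uniformly on every `S ⊆ ℍ` whose closure is compact and
misses `A'`; values of `Φ_{A_n}` off `ℍ ∖ A_n` are junk, and since `S̄` is compact and misses
`A' = ⋂ₙ A_n`, `S ∩ A_n = ∅` for all large `n` (`eventually_disjoint_of_iInter_eq`), so only
genuine values enter the eventual estimate.
[cite: LawlerSchrammWerner2003Restriction, Lemma 2.1 and its proof (p. 8); Lemma 3.5, its convergence notion (p. 12) and its proof (p. 13, the sets A' and E_δ)] -/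
def IsPlusHull.exists_antitone_isArcHull : Prop :=
  ∀ {A : Set ℂ}, IsPlusHull A → A.Nonempty →
    ∃ J : ℕ → Set ℂ, (∀ n, IsArcHull (J n)) ∧ (∀ n, IsPlusHull (J n)) ∧ Antitone J ∧
      (⋂ n, J n) = realFill A ∧
      ∀ {Φ : ConformalEquiv (upperHalfPlaneSet \ A) upperHalfPlaneSet}
        {Ψ : ∀ n, ConformalEquiv (upperHalfPlaneSet \ J n) upperHalfPlaneSet},
        IsRestrictionMap A Φ → (∀ n, IsRestrictionMap (J n) (Ψ n)) →
        (∀ S ⊆ upperHalfPlaneSet, IsCompact (closure S) → Disjoint (closure S) (realFill A) →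
            TendstoUniformlyOn (fun n z ↦ Ψ n z) (fun z ↦ Φ z) atTop S) ∧
        ∀ {d : ℝ} {dn : ℕ → ℝ}, HasRestrictionDeriv A Φ d →
          (∀ n, HasRestrictionDeriv (J n) (Ψ n) (dn n)) → Monotone dn ∧ Tendsto dn atTop (𝓝 d)

/-! ### The `±`-factorisation of `*`-hulls -/

/-- NAMED FACT — **factorisation of a `*`-hull into a `+`-hull and a `−`-hull** ([LSW] §2
p. 8, verbatim: "If `A ∈ 𝒬*`, then we can find unique `A₁, A₃ ∈ 𝒬₊` and `A₂, A₄ ∈ 𝒬₋` such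
that `A = A₁ · A₂ = A₄ · A₃`"), existence half of the first factorisation, with the product
`A₁ · A₂` (defined by `Φ_{A₁·A₂} = Φ_{A₁} ∘ Φ_{A₂}`) in the predicate form
`RestrictionConfig.IsHullProduct A₁ A₂ A` of `RestrictionMeasures`
(`ℍ ∖ A = Φ_{A₂}⁻¹(ℍ ∖ A₁)`). [cite: LawlerSchrammWerner2003Restriction, §2 p. 8 (±-hulls)] -/
def IsStarHull.exists_isHullProduct_plus_minus : Prop :=
  ∀ {A : Set ℂ}, IsStarHull A →
    ∃ A₁ A₂ : Set ℂ, IsPlusHull A₁ ∧ IsMinusHull A₂ ∧ RestrictionConfig.IsHullProduct A₁ A₂ A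

/-! ### Multiplicativity of avoidance probabilities over smooth hulls -/

/-- **`𝒜₁`-covariance over smooth hulls, homomorphism form**: the identity
`P[K ∩ (A · J) = ∅] = P[K ∩ A = ∅] · P[K ∩ J = ∅]` of `RestrictionConfig.IsHullMultiplicative`
([LSW] Prop. 3.3 (1) with §2 p. 9), but only for SMOOTH `*`-hulls `J` (`IsArcHull`) — which is
what two-sided restriction over Jordan hull subdomains yields after pull-back to `(ℍ; 0, ∞)`,
the domains `ℍ ∖ J` being Jordan domains of the sphere exactly for such `J`. Upgraded to all of
`𝒬*` in `RestrictionCovariance`. [cite: LawlerSchrammWerner2003Restriction, Prop. 3.3 (1) (p. 10) with §2 p. 9 (F homomorphism), smooth hulls p. 8] -/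
def RestrictionConfig.IsArcHullMultiplicative (P : MeasureTheory.Measure RestrictionConfig) : Prop :=
  ∀ A J B : Set ℂ, IsStarHull A → IsArcHull J → IsStarHull J → RestrictionConfig.IsHullProduct A J B →
    P (RestrictionConfig.avoid B) = P (RestrictionConfig.avoid A) * P (RestrictionConfig.avoid J)

/-- Full multiplicativity restricts to smooth hulls (sanity check of the direction of the
upgrade). [folklore] -/
theorem RestrictionConfig.IsHullMultiplicative.isArcHullMultiplicative
    {P : MeasureTheory.Measure RestrictionConfig} (h : RestrictionConfig.IsHullMultiplicative P) :
    RestrictionConfig.IsArcHullMultiplicative P :=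
  fun A J B hA _ hJ hB ↦ h A J B hA hJ hB

/-! ### A bounded hull has no floating pieces -/

section NoFloat

variable {A : Set ℂ}

/-- The lower closed half-plane `{Im ≤ 0}` is connected. [folklore] -/
theorem isConnected_setOf_im_nonpos : IsConnected {z : ℂ | z.im ≤ 0} :=
  ⟨⟨0, by simp⟩, (convex_halfSpace_im_le 0).isPreconnected⟩

/-- **A bounded hull has no floating pieces**: for `A ∈ 𝒬`, `A ∪ {Im ≤ 0}` is connected.
Otherwise `A` has a nonempty closed piece `Y ⊆ ℍ`, clopen in `A ∪ {Im ≤ 0}`; the ring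
`K = {δ ≤ dist(·, Y) ≤ 3δ}` (for `4δ` below the distance from `Y` to the rest) is a compact subset
of the simply connected open set `ℍ ∖ A`, on which `(z - y₀)/(z - y')` (`y₀ ∈ Y`, `y'` far below)
has a continuous logarithm (`Complex.exists_continuousOn_eqOn_exp_comp`), contradicting Borsuk's
criterion `Janiszewski.not_exists_log_of_isBounded`, the component of `y₀` in `ℂ ∖ K` being
trapped in `{dist(·, Y) < δ}`. [folklore] -/
theorem IsBoundedHull.isConnected_union_im_nonpos (hA : IsBoundedHull A) :
    IsConnected (A ∪ {z : ℂ | z.im ≤ 0}) := by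
  classical
  set L : Set ℂ := {z : ℂ | z.im ≤ 0} with hLdef
  have hLc : IsClosed L := isClosed_le continuous_im continuous_const
  set T : Set ℂ := A ∪ L with hTdef
  have hTc : IsClosed T := hA.isClosed.union hLc
  by_contra hcon
  have hnp : ¬ IsPreconnected T := fun hp ↦ hcon ⟨⟨0, Or.inr (by simp [hLdef])⟩, hp⟩
  rw [isPreconnected_iff_subset_of_disjoint_closed] at hnp
  push Not at hnp
  obtain ⟨u, v, hu, hv, hTuv, hTi, hTu, hTv⟩ := hnp
  have hLuv : L ⊆ u ∨ L ⊆ v := by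
    refine isPreconnected_iff_subset_of_disjoint_closed.1 isConnected_setOf_im_nonpos.2 u v hu hv
      (subset_union_right.trans hTuv) ?_
    rw [← subset_empty_iff, ← hTi]
    exact inter_subset_inter_left _ subset_union_right
  -- without loss of generality `L ⊆ u`
  wlog hLu : L ⊆ u generalizing u v
  · exact this v u hv hu (by rwa [union_comm]) (by rwa [inter_comm v u]) hTv hTu hLuv.symm
      (hLuv.resolve_left hLu)
  -- the floating piece `Y` and the rest `X`
  set Y : Set ℂ := T ∩ v with hYdef
  set X : Set ℂ := T ∩ u with hXdef
  have hYc : IsClosed Y := hTc.inter hv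
  have hXc : IsClosed X := hTc.inter hu
  have hXY : Disjoint X Y := by
    rw [Set.disjoint_iff_inter_eq_empty, ← subset_empty_iff, ← hTi]
    rintro z ⟨⟨hzT, hzu⟩, -, hzv⟩
    exact ⟨hzT, hzu, hzv⟩
  have hLX : L ⊆ X := fun z hz ↦ ⟨Or.inr hz, hLu hz⟩
  have hYne : Y.Nonempty := by
    obtain ⟨z, hzT, hzu⟩ := not_subset.1 hTu
    exact ⟨z, hzT, (hTuv hzT).resolve_left hzu⟩
  have hYA : Y ⊆ A := by
    rintro z ⟨hzT | hzL, hzv⟩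
    · exact hzT
    · exact absurd (⟨hLX hzL, Or.inr hzL, hzv⟩ : z ∈ X ∩ Y) (Set.disjoint_left.1 hXY (hLX hzL) ∘ fun h ↦ h.2)
  have hYH : Y ⊆ upperHalfPlaneSet := fun z hz ↦ by
    by_contra h
    exact Set.disjoint_left.1 hXY (hLX (show z.im ≤ 0 from not_lt.1 h)) hz
  have hYcpt : IsCompact Y := hA.isCompact.of_isClosed_subset hYc hYA
  have hXne : X.Nonempty := ⟨0, hLX (by simp [hLdef])⟩
  -- positive distance from `Y` to `X`
  obtain ⟨y₁, hy₁, hmin⟩ := hYcpt.exists_isMinOn hYne (continuous_infDist_pt (s := X)).continuousOn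
  set δ₀ : ℝ := infDist y₁ X with hδ₀def
  have hδ₀ : 0 < δ₀ := by
    rw [hδ₀def, ← infDist_pos_iff_notMem_closure hXne, hXc.closure_eq]
    exact fun h ↦ Set.disjoint_left.1 hXY h hy₁
  have hdist : ∀ y ∈ Y, ∀ x ∈ X, δ₀ ≤ dist y x := fun y hy x hx ↦
    (hmin hy).trans (infDist_le_dist_of_mem hx)
  set δ : ℝ := δ₀ / 4 with hδdef
  have hδ : 0 < δ := by positivity
  -- the ring `K`
  set K : Set ℂ := {z | δ ≤ infDist z Y ∧ infDist z Y ≤ 3 * δ} with hKdef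
  have hKc : IsClosed K :=
    (isClosed_le continuous_const (continuous_infDist_pt Y)).inter
      (isClosed_le (continuous_infDist_pt Y) continuous_const)
  obtain ⟨R, hR⟩ := hYcpt.isBounded.subset_closedBall 0
  have hKb : IsBounded K := by
    refine isBounded_iff_forall_norm_le.2 ⟨R + (3 * δ + 1), fun z hz ↦ ?_⟩
    obtain ⟨y, hy, hzy⟩ := (infDist_lt_iff hYne).1 (show infDist z Y < 3 * δ + 1 by linarith [hz.2])
    have hyR : ‖y‖ ≤ R := mem_closedBall_zero_iff.1 (hR hy)
    calc ‖z‖ = ‖(z - y) + y‖ := by ring_nf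
      _ ≤ ‖z - y‖ + ‖y‖ := norm_add_le _ _
      _ ≤ R + (3 * δ + 1) := by rw [← dist_eq_norm]; linarith
  have hKcpt : IsCompact K := Metric.isCompact_of_isClosed_isBounded hKc hKb
  have hKU : K ⊆ upperHalfPlaneSet \ A := by
    intro z hz
    have hzY : z ∉ Y := fun h ↦ by
      have := infDist_zero_of_mem (x := z) h
      linarith [hz.1]
    have hzX : z ∉ X := fun h ↦ by
      have : δ₀ ≤ infDist z Y := (le_infDist hYne).2 fun y hy ↦ by
        rw [dist_comm]; exact hdist y hy z h
      linarith [hz.2]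
    have hzT : z ∉ T := fun h ↦ by
      rcases hTuv h with hzu | hzv
      · exact hzX ⟨h, hzu⟩
      · exact hzY ⟨h, hzv⟩
    exact ⟨show (0 : ℝ) < z.im from lt_of_not_ge fun h ↦ hzT (Or.inr h), fun h ↦ hzT (Or.inl h)⟩
  -- the two special points
  obtain ⟨y₀, hy₀⟩ := hYne
  have hy₀K : y₀ ∉ K := fun h ↦ by
    have := infDist_zero_of_mem (x := y₀) hy₀
    linarith [h.1]
  set y' : ℂ := -((R + (3 * δ + 1) : ℝ) : ℂ) * Complex.I with hy'def
  have hy'im : y'.im = -(R + (3 * δ + 1)) := by simp [hy'def]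
  have hRnn : 0 ≤ R := by
    have := hR hy₀
    rw [mem_closedBall, dist_zero_right] at this
    exact (norm_nonneg _).trans this
  have hy'far : ∀ y ∈ Y, 3 * δ < dist y' y := fun y hy ↦ by
    have hyim : 0 < y.im := hYH hy
    have h1 : |(y' - y).im| ≤ ‖y' - y‖ := Complex.abs_im_le_norm _
    rw [dist_eq_norm]
    have h2 : (y' - y).im = -(R + (3 * δ + 1)) - y.im := by rw [sub_im, hy'im]
    rw [h2] at h1
    have h3 : |(-(R + (3 * δ + 1)) - y.im)| = R + (3 * δ + 1) + y.im := by
      rw [abs_of_neg (by linarith)]; ring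
    linarith
  have hy'inf : 3 * δ < infDist y' Y := by
    obtain ⟨y, hy, hyeq⟩ := hYc.exists_infDist_eq_dist ⟨y₀, hy₀⟩ y'
    rw [hyeq]
    exact hy'far y hy
  have hy'K : y' ∉ K := fun h ↦ by linarith [h.2]
  have hy'U : y' ∉ upperHalfPlaneSet \ A := fun h ↦ by
    have : 0 < y'.im := h.1
    rw [hy'im] at this
    linarith
  -- the component of `y₀` in `ℂ ∖ K` is trapped near `Y`
  set C : Set ℂ := connectedComponentIn Kᶜ y₀ with hCdef
  have hCsub : C ⊆ {z | infDist z Y < δ} := by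
    have hopen₁ : IsOpen {z : ℂ | infDist z Y < δ} :=
      isOpen_lt (continuous_infDist_pt Y) continuous_const
    have hopen₂ : IsOpen {z : ℂ | 3 * δ < infDist z Y} :=
      isOpen_lt continuous_const (continuous_infDist_pt Y)
    have hdisj : Disjoint {z : ℂ | infDist z Y < δ} {z : ℂ | 3 * δ < infDist z Y} := by
      rw [Set.disjoint_left]
      intro z hz hz'
      simp only [mem_setOf_eq] at hz hz'
      linarith
    have hCKc : C ⊆ {z : ℂ | infDist z Y < δ} ∪ {z : ℂ | 3 * δ < infDist z Y} := by
      intro z hz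
      have hzK : z ∈ Kᶜ := connectedComponentIn_subset _ _ hz
      simp only [mem_compl_iff, hKdef, mem_setOf_eq, not_and_or, not_le] at hzK
      rcases hzK with h | h
      · exact Or.inl h
      · exact Or.inr h
    rcases isPreconnected_connectedComponentIn.subset_or_subset hopen₁ hopen₂ hdisj hCKc with h | h
    · exact h
    · exfalso
      have hy₀C : y₀ ∈ C := mem_connectedComponentIn hy₀K
      have := h hy₀C
      simp only [mem_setOf_eq, infDist_zero_of_mem hy₀] at this
      linarith
  have hCb : IsBounded C := by
    refine (isBounded_iff_forall_norm_le.2 ⟨R + δ, fun z hz ↦ ?_⟩)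
    have hz' : infDist z Y < δ := hCsub hz
    obtain ⟨y, hy, hzy⟩ := (infDist_lt_iff ⟨y₀, hy₀⟩).1 hz'
    have hyR : ‖y‖ ≤ R := mem_closedBall_zero_iff.1 (hR hy)
    calc ‖z‖ = ‖(z - y) + y‖ := by ring_nf
      _ ≤ ‖z - y‖ + ‖y‖ := norm_add_le _ _
      _ ≤ R + δ := by rw [← dist_eq_norm]; linarith
  have hy'C : y' ∉ C := fun h ↦ by
    have := hCsub h
    simp only [mem_setOf_eq] at this
    linarith
  -- Borsuk: no logarithm of `(z - y₀)/(z - y')` on `K` ...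
  have hB := Literature.Topology.PlaneTopology.Janiszewski.not_exists_log_of_isBounded hKcpt hy₀K hCb hy'C hy'K
  -- ... but there is one on the simply connected `ℍ ∖ A ⊇ K`
  have hUo : IsOpen (upperHalfPlaneSet \ A) := isOpen_upperHalfPlaneSet.sdiff hA.isClosed
  set q : ℂ → ℂ := fun z ↦ (z - y₀) / (z - y') with hqdef
  have hy₀U : y₀ ∉ upperHalfPlaneSet \ A := fun h ↦ h.2 (hYA hy₀)
  have hqc : ContinuousOn q (upperHalfPlaneSet \ A) := by
    refine ContinuousOn.div (by fun_prop) (by fun_prop) fun z hz h0 ↦ ?_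
    exact hy'U (sub_eq_zero.1 h0 ▸ hz)
  have hq0 : (0 : ℂ) ∉ q '' (upperHalfPlaneSet \ A) := by
    rintro ⟨z, hz, hqz⟩
    rw [hqdef, div_eq_zero_iff] at hqz
    rcases hqz with h | h
    · exact hy₀U (sub_eq_zero.1 h ▸ hz)
    · exact hy'U (sub_eq_zero.1 h ▸ hz)
  obtain ⟨f, hfc, hfq⟩ := Complex.exists_continuousOn_eqOn_exp_comp hA.2.2 hUo hqc hq0
  exact hB ⟨f, hfc.mono hKU, fun z hz ↦ hfq (hKU hz)⟩

end NoFloat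

/-! ### The reflection about the imaginary axis -/

section Reflection

variable {A : Set ℂ}

/-- **The reflection `σ(z) = -z̄` about the imaginary axis** ([LSW] §2 p. 8: "Let `σ` denote
the orthogonal reflection about the imaginary axis"), as a self-homeomorphism of `ℂ`.
[cite: LawlerSchrammWerner2003Restriction, §2 p. 8 (±-hulls)] -/
def imagAxisRefl : ℂ ≃ₜ ℂ where
  toFun z := -conj z
  invFun z := -conj z
  left_inv z := by simp
  right_inv z := by simp
  continuous_toFun := by fun_prop
  continuous_invFun := by fun_prop

/-- Unfolding `imagAxisRefl`. [folklore] -/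
@[simp] theorem imagAxisRefl_apply (z : ℂ) : imagAxisRefl z = -conj z := rfl

/-- `σ` is an involution. [folklore] -/
@[simp] theorem imagAxisRefl_imagAxisRefl (z : ℂ) : imagAxisRefl (imagAxisRefl z) = z := by simp

/-- `σ` preserves imaginary parts. [folklore] -/
@[simp] theorem imagAxisRefl_im (z : ℂ) : (imagAxisRefl z).im = z.im := by simp

/-- `σ` negates real parts. [folklore] -/
@[simp] theorem imagAxisRefl_re (z : ℂ) : (imagAxisRefl z).re = -z.re := by simp

/-- `σ(0) = 0`. [folklore] -/
@[simp] theorem imagAxisRefl_zero : imagAxisRefl 0 = 0 := by simp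

/-- `σ` on real points. [folklore] -/
theorem imagAxisRefl_ofReal (x : ℝ) : imagAxisRefl (x : ℂ) = ((-x : ℝ) : ℂ) := by
  simp [Complex.conj_ofReal]

/-- `σ` is norm-preserving. [folklore] -/
@[simp] theorem norm_imagAxisRefl (z : ℂ) : ‖imagAxisRefl z‖ = ‖z‖ := by
  simp

/-- `σ` is distance-preserving. [folklore] -/
@[simp] theorem dist_imagAxisRefl (z w : ℂ) : dist (imagAxisRefl z) (imagAxisRefl w) = dist z w := by
  rw [dist_eq_norm, dist_eq_norm, imagAxisRefl_apply, imagAxisRefl_apply,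
    show -conj z - -conj w = -(conj (z - w)) by simp [map_sub]; ring, norm_neg, Complex.norm_conj]

/-- `σ ∘ σ = id` on sets. [folklore] -/
@[simp] theorem imagAxisRefl_image_image (S : Set ℂ) : imagAxisRefl '' (imagAxisRefl '' S) = S := by
  rw [image_image]
  simp

/-- `σ⁻¹(S) = σ(S)`. [folklore] -/
theorem imagAxisRefl_preimage (S : Set ℂ) : imagAxisRefl ⁻¹' S = imagAxisRefl '' S := by
  ext z
  constructor
  · intro hz
    exact ⟨imagAxisRefl z, hz, imagAxisRefl_imagAxisRefl z⟩
  · rintro ⟨w, hw, rfl⟩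
    simpa using hw

/-- `σ(ℍ) = ℍ`. [folklore] -/
@[simp] theorem imagAxisRefl_image_upperHalfPlaneSet :
    imagAxisRefl '' upperHalfPlaneSet = upperHalfPlaneSet := by
  ext z
  constructor
  · rintro ⟨w, hw, rfl⟩
    simpa using hw
  · intro hz
    exact ⟨imagAxisRefl z, by simpa using hz, imagAxisRefl_imagAxisRefl z⟩

/-- `σ(S ∩ ℍ) = σ(S) ∩ ℍ`. [folklore] -/
theorem imagAxisRefl_image_inter_upperHalfPlaneSet (S : Set ℂ) :
    imagAxisRefl '' (S ∩ upperHalfPlaneSet) = imagAxisRefl '' S ∩ upperHalfPlaneSet := by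
  rw [image_inter imagAxisRefl.injective, imagAxisRefl_image_upperHalfPlaneSet]

/-- `σ(ℍ ∖ S) = ℍ ∖ σ(S)`. [folklore] -/
theorem imagAxisRefl_image_diff (S : Set ℂ) :
    imagAxisRefl '' (upperHalfPlaneSet \ S) = upperHalfPlaneSet \ imagAxisRefl '' S := by
  rw [image_sdiff imagAxisRefl.injective, imagAxisRefl_image_upperHalfPlaneSet]

/-- **`𝒬` is `σ`-invariant.** [folklore] -/
theorem IsBoundedHull.image_imagAxisRefl (hA : IsBoundedHull A) : IsBoundedHull (imagAxisRefl '' A) := by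
  obtain ⟨hb, hcl, hsc⟩ := hA
  refine ⟨?_, ?_, ?_⟩
  · obtain ⟨R, hR⟩ := hb.subset_closedBall 0
    refine (isBounded_closedBall (x := (0 : ℂ)) (r := R)).subset ?_
    rintro _ ⟨z, hz, rfl⟩
    simpa using hR hz
  · rw [← imagAxisRefl_image_inter_upperHalfPlaneSet, ← imagAxisRefl.image_closure, hcl]
  · rw [← imagAxisRefl_image_diff]
    exact (imagAxisRefl.isSimplyConnected_image).2 hsc

/-- **`𝒬*` is `σ`-invariant.** [folklore] -/
theorem IsStarHull.image_imagAxisRefl (hA : IsStarHull A) : IsStarHull (imagAxisRefl '' A) := by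
  refine ⟨hA.1.image_imagAxisRefl, ?_⟩
  rintro ⟨z, hz, hz0⟩
  have : z = 0 := by simpa using congrArg Literature.Probability.RandomPlanarGeometry.imagAxisRefl hz0
  exact hA.2 (this ▸ hz)

/-- `σ(𝒬₊) ⊆ 𝒬₋`. [cite: LawlerSchrammWerner2003Restriction, §2 p. 8 (𝒬₋ = σ(𝒬₊))] -/
theorem IsPlusHull.image_imagAxisRefl (hA : IsPlusHull A) : IsMinusHull (imagAxisRefl '' A) := by
  refine ⟨hA.1.image_imagAxisRefl, ?_⟩
  rintro x ⟨z, hz, hzx⟩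
  have hz' : z = ((-x : ℝ) : ℂ) := by
    have := congrArg Literature.Probability.RandomPlanarGeometry.imagAxisRefl hzx
    rwa [imagAxisRefl_imagAxisRefl, imagAxisRefl_ofReal] at this
  have := hA.2 (-x) (hz' ▸ hz)
  linarith

/-- `σ(𝒬₋) ⊆ 𝒬₊`. [cite: LawlerSchrammWerner2003Restriction, §2 p. 8 (𝒬₋ = σ(𝒬₊))] -/
theorem IsMinusHull.image_imagAxisRefl (hA : IsMinusHull A) : IsPlusHull (imagAxisRefl '' A) := by
  refine ⟨hA.1.image_imagAxisRefl, ?_⟩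
  rintro x ⟨z, hz, hzx⟩
  have hz' : z = ((-x : ℝ) : ℂ) := by
    have := congrArg Literature.Probability.RandomPlanarGeometry.imagAxisRefl hzx
    rwa [imagAxisRefl_imagAxisRefl, imagAxisRefl_ofReal] at this
  have := hA.2 (-x) (hz' ▸ hz)
  linarith

/-- **Smooth hulls are `σ`-invariant** (reflect the arc). [folklore] -/
theorem IsArcHull.image_imagAxisRefl (hA : IsArcHull A) : IsArcHull (imagAxisRefl '' A) := by
  obtain ⟨hh, γ, hγc, hγi, h0, h1, hI, hfr⟩ := hA
  refine ⟨hh.image_imagAxisRefl, fun t ↦ Literature.Probability.RandomPlanarGeometry.imagAxisRefl (γ t),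
    imagAxisRefl.continuous.comp_continuousOn hγc, imagAxisRefl.injective.comp_injOn hγi,
    by simpa using h0, by simpa using h1, fun t ht ↦ by simpa using hI t ht, ?_⟩
  rw [← imagAxisRefl.image_frontier, show (fun t ↦ imagAxisRefl (γ t)) = imagAxisRefl ∘ γ from rfl,
    image_comp, ← hfr, image_inter imagAxisRefl.injective, imagAxisRefl_image_upperHalfPlaneSet]

/-! #### Reflecting conformal maps: `σ ∘ Φ ∘ σ` -/

/-- `z ↦ σ(f(σ z))` is complex differentiable where `f` is (it is `conj ∘ (−f(−·)) ∘ conj`). [folklore] -/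
theorem differentiableAt_imagAxisRefl_comp {f : ℂ → ℂ} {z : ℂ}
    (hf : DifferentiableAt ℂ f (imagAxisRefl z)) :
    DifferentiableAt ℂ (fun w ↦ imagAxisRefl (f (imagAxisRefl w))) z := by
  have h1 : DifferentiableAt ℂ (fun w ↦ -f (-w)) (conj z) := by
    have : DifferentiableAt ℂ f (-(conj z)) := by simpa using hf
    exact (this.comp _ differentiableAt_id.neg).neg
  have h2 := DifferentiableAt.conj_conj h1
  rw [Complex.conj_conj] at h2
  have heq : (fun w ↦ imagAxisRefl (f (imagAxisRefl w))) = conj ∘ (fun w ↦ -f (-w)) ∘ conj := by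
    funext w
    simp [Function.comp_def]
  rw [heq]
  exact h2

variable {U V : Set ℂ}

/-- **The reflected conformal map `σ ∘ Φ ∘ σ : σ(U) → σ(V)`** of a conformal map `Φ : U → V`
between open sets ([LSW] §2 p. 8, "by symmetry": `Φ_{σ(A)} = σ ∘ Φ_A ∘ σ`). [folklore] -/
def ConformalEquiv.reflect (Φ : ConformalEquiv U V) (hU : IsOpen U) (hV : IsOpen V) :
    ConformalEquiv (imagAxisRefl '' U) (imagAxisRefl '' V) where
  toFun z := imagAxisRefl (Φ (imagAxisRefl z))
  invFun w := imagAxisRefl (Φ.symm (imagAxisRefl w))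
  source := imagAxisRefl '' U
  target := imagAxisRefl '' V
  map_source' := by
    rintro _ ⟨z, hz, rfl⟩
    refine ⟨Φ z, Φ.mapsTo hz, ?_⟩
    simp
  map_target' := by
    rintro _ ⟨w, hw, rfl⟩
    refine ⟨Φ.symm w, Φ.symm_mapsTo hw, ?_⟩
    simp
  left_inv' := by
    rintro _ ⟨z, hz, rfl⟩
    simp [Φ.symm_apply_apply hz]
  right_inv' := by
    rintro _ ⟨w, hw, rfl⟩
    simp [Φ.apply_symm_apply hw]
  source_eq := rfl
  target_eq := rfl
  differentiableOn := by
    rintro _ ⟨z, hz, rfl⟩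
    refine (differentiableAt_imagAxisRefl_comp ?_).differentiableWithinAt
    rw [imagAxisRefl_imagAxisRefl]
    exact (Φ.differentiableOn z hz).differentiableAt (hU.mem_nhds hz)
  differentiableOn_symm := by
    rintro _ ⟨w, hw, rfl⟩
    refine (differentiableAt_imagAxisRefl_comp ?_).differentiableWithinAt
    rw [imagAxisRefl_imagAxisRefl]
    exact (Φ.differentiableOn_symm w hw).differentiableAt (hV.mem_nhds hw)

/-- Unfolding the reflected map. [folklore] -/
@[simp] theorem ConformalEquiv.reflect_apply (Φ : ConformalEquiv U V) (hU : IsOpen U) (hV : IsOpen V)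
    (z : ℂ) : Φ.reflect hU hV z = imagAxisRefl (Φ (imagAxisRefl z)) := rfl

/-- The reflected restriction map of `A`, as a map `ℍ ∖ σ(A) → ℍ`. [folklore] -/
def ConformalEquiv.reflectHull (hA : IsClosed A)
    (Φ : ConformalEquiv (upperHalfPlaneSet \ A) upperHalfPlaneSet) :
    ConformalEquiv (upperHalfPlaneSet \ imagAxisRefl '' A) upperHalfPlaneSet :=
  (Φ.reflect (isOpen_upperHalfPlaneSet.sdiff hA) isOpen_upperHalfPlaneSet).copy _ _
    (imagAxisRefl_image_diff A).symm imagAxisRefl_image_upperHalfPlaneSet.symm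

/-- Unfolding `reflectHull`. [folklore] -/
@[simp] theorem ConformalEquiv.reflectHull_apply (hA : IsClosed A)
    (Φ : ConformalEquiv (upperHalfPlaneSet \ A) upperHalfPlaneSet) (z : ℂ) :
    Φ.reflectHull hA z = imagAxisRefl (Φ (imagAxisRefl z)) := rfl

/-- `σ` maps neighbourhoods within `σ(S)` of `0` to neighbourhoods within `S` of `0`. [folklore] -/
theorem tendsto_imagAxisRefl_nhdsWithin (S : Set ℂ) :
    Tendsto imagAxisRefl (𝓝[imagAxisRefl '' S] 0) (𝓝[S] 0) := by
  have h := imagAxisRefl.continuous.continuousWithinAt.tendsto_nhdsWithin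
    (s := imagAxisRefl '' S) (t := S) (x := 0) ?_
  · simpa using h
  · rintro _ ⟨z, hz, rfl⟩
    simpa using hz

/-- `σ` maps the filter "`∞` within `σ(S)`" to "`∞` within `S`". [folklore] -/
theorem tendsto_imagAxisRefl_cocompact_inf (S : Set ℂ) :
    Tendsto imagAxisRefl (cocompact ℂ ⊓ 𝓟 (imagAxisRefl '' S)) (cocompact ℂ ⊓ 𝓟 S) := by
  refine Tendsto.inf ?_ ?_
  · exact imagAxisRefl.toCocompactMap.cocompact_tendsto'
  · rw [tendsto_principal_principal]
    rintro _ ⟨z, hz, rfl⟩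
    simpa using hz

/-- Transporting a restriction map along an equality of hulls (same underlying map). [folklore] -/
theorem IsRestrictionMap.of_eq {A A' : Set ℂ}
    {Φ : ConformalEquiv (upperHalfPlaneSet \ A) upperHalfPlaneSet} (hΦ : IsRestrictionMap A Φ)
    (h : A = A') : IsRestrictionMap A' (Φ.copy _ _ (by rw [h]) rfl) := by
  subst h
  exact hΦ

/-- **The reflection of a restriction map of `A` is a restriction map of `σ(A)`**
(`Φ_{σ(A)} = σ ∘ Φ_A ∘ σ`: boundary value `0` at `0`, `σΦσ(z)/z = conj(Φ(σz)/σz) → 1` at `∞`).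
[cite: LawlerSchrammWerner2003Restriction, §2 p. 8 (𝒬₋ = σ(𝒬₊), by symmetry)] -/
theorem IsRestrictionMap.reflectHull (hA : IsClosed A)
    {Φ : ConformalEquiv (upperHalfPlaneSet \ A) upperHalfPlaneSet} (hΦ : IsRestrictionMap A Φ) :
    IsRestrictionMap (imagAxisRefl '' A) (Φ.reflectHull hA) := by
  constructor
  · -- boundary value `0` at `0`
    show Tendsto (fun z ↦ imagAxisRefl (Φ (imagAxisRefl z))) (𝓝[upperHalfPlaneSet \ imagAxisRefl '' A] 0) (𝓝 0)
    rw [← imagAxisRefl_image_diff]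
    have h1 := hΦ.1.comp (tendsto_imagAxisRefl_nhdsWithin (upperHalfPlaneSet \ A))
    have h2 := (imagAxisRefl.continuous.tendsto 0).comp h1
    simpa [Function.comp_def] using h2
  · show Tendsto (fun z ↦ imagAxisRefl (Φ (imagAxisRefl z)) / z)
      (cocompact ℂ ⊓ 𝓟 (upperHalfPlaneSet \ imagAxisRefl '' A)) (𝓝 1)
    rw [← imagAxisRefl_image_diff]
    have h1 := hΦ.2.comp (tendsto_imagAxisRefl_cocompact_inf (upperHalfPlaneSet \ A))
    have h2 : Tendsto (fun z ↦ conj (Φ (imagAxisRefl z) / imagAxisRefl z))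
        (cocompact ℂ ⊓ 𝓟 (imagAxisRefl '' (upperHalfPlaneSet \ A))) (𝓝 (conj 1)) :=
      (Complex.continuous_conj.tendsto 1).comp h1
    rw [map_one] at h2
    refine h2.congr fun z ↦ ?_
    simp only [imagAxisRefl_apply, map_div₀, Complex.conj_conj, map_neg]
    field_simp

/-- **Uniform convergence is transported by `σ`**: if the reflected maps converge uniformly on
`σ(S)`, the maps converge uniformly on `S`. [folklore] -/
theorem tendstoUniformlyOn_of_imagAxisRefl {F : ℕ → ℂ → ℂ} {f : ℂ → ℂ} {S : Set ℂ}
    (h : TendstoUniformlyOn (fun n z ↦ imagAxisRefl (F n (imagAxisRefl z)))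
      (fun z ↦ imagAxisRefl (f (imagAxisRefl z))) atTop (imagAxisRefl '' S)) :
    TendstoUniformlyOn F f atTop S := by
  rw [Metric.tendstoUniformlyOn_iff] at h ⊢
  intro ε hε
  filter_upwards [h ε hε] with n hn z hz
  have := hn (imagAxisRefl z) ⟨z, hz, rfl⟩
  simpa only [imagAxisRefl_imagAxisRefl, dist_imagAxisRefl] using this

end Reflection

/-! ### Packaged outer approximation of nonempty `±`-hulls by smooth `*`-hulls -/

section Approx

variable {A : Set ℂ}

/-- A nonempty bounded hull has real points (`IsBoundedHull.isConnected_union_im_nonpos`). [folklore] -/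
theorem IsBoundedHull.realTrace_nonempty (hA : IsBoundedHull A) (hne : A.Nonempty) :
    (realTrace A).Nonempty := by
  by_contra hno
  rw [not_nonempty_iff_eq_empty] at hno
  have him : ∀ z ∈ A, 0 ≤ z.im := fun z hz ↦ by
    have := hA.subset_closure hz
    rwa [show upperHalfPlaneSet = {z : ℂ | 0 < z.im} from rfl, closure_setOf_lt_im] at this
  have hAH : A ⊆ upperHalfPlaneSet := fun z hz ↦ by
    rcases (him z hz).lt_or_eq with hlt | heq
    · exact hlt
    · exfalso
      have hzre : ((z.re : ℝ) : ℂ) = z := Complex.ext (by simp) (by simp [heq])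
      have : z.re ∈ realTrace A := by rw [mem_realTrace, hzre]; exact hz
      rw [hno] at this
      exact this
  have hpre := (hA.isConnected_union_im_nonpos).isPreconnected
  rw [isPreconnected_iff_subset_of_disjoint_closed] at hpre
  have hLc : IsClosed {z : ℂ | z.im ≤ 0} := isClosed_le continuous_im continuous_const
  rcases hpre A {z : ℂ | z.im ≤ 0} hA.isClosed hLc subset_rfl (by
    rw [← subset_empty_iff]
    rintro z ⟨-, hzA, hzL⟩
    exact absurd (show 0 < z.im from hAH hzA) (not_lt.2 hzL)) with h1 | h1
  · have hmem : (-Complex.I) ∈ A := h1 (Or.inr (by simp))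
    have := hAH hmem
    simp only [upperHalfPlaneSet, mem_setOf_eq, neg_im, I_im] at this
    linarith
  · obtain ⟨a, ha⟩ := hne
    have ha' : a.im ≤ 0 := h1 (Or.inl ha)
    exact absurd (show 0 < a.im from hAH ha) (not_lt.2 ha')

/-- For a nonempty `A ∈ 𝒬₊`, `x₀ = inf (A ∩ ℝ) > 0`, so `0 ∉ A' = A ∪ [x₀, x₁]`. [folklore] -/
theorem IsPlusHull.zero_notMem_realFill (hA : IsPlusHull A) (hne : A.Nonempty) :
    (0 : ℂ) ∉ realFill A := by
  rintro (h0 | ⟨x, hx, hx0⟩)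
  · exact hA.1.zero_notMem h0
  · have hx0' : x = 0 := by
      have h' : ((x : ℝ) : ℂ) = 0 := hx0
      exact_mod_cast h'
    have hT : IsCompact (realTrace A) := isCompact_realTrace hA.1.isBoundedHull.isCompact
    have hTne : (realTrace A).Nonempty := hA.1.isBoundedHull.realTrace_nonempty hne
    have hmem : sInf (realTrace A) ∈ realTrace A := hT.sInf_mem hTne
    have hpos : 0 < sInf (realTrace A) := hA.2 _ hmem
    rw [hx0'] at hx
    linarith [hx.1]

/-- **Outer approximation by smooth `*`-hulls with convergence of the restriction maps**: there
are decreasing smooth `*`-hulls `J n` whose intersection `F` (think `F = A' = A ∪ [x₀, x₁]`, the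
real filling) contains `A`, adds to `A` only real points (`F ∩ ℍ ⊆ A`) and misses `0`, such that
for all restriction maps `Φ_{J n} → Φ_A` uniformly on every `S ⊆ ℍ` with compact closure missing
`F` (the conclusion of [LSW] Lemma 2.1 read through the proof of Lemma 3.5, minus the derivative
clause). [cite: LawlerSchrammWerner2003Restriction, Lemma 2.1 (p. 8) with Lemma 3.5 (pp. 12–13)] -/
def HasArcApprox (A : Set ℂ) : Prop :=
  ∃ (J : ℕ → Set ℂ) (F : Set ℂ), (∀ n, IsArcHull (J n)) ∧ (∀ n, IsStarHull (J n)) ∧ Antitone J ∧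
    (⋂ n, J n) = F ∧ A ⊆ F ∧ F ∩ upperHalfPlaneSet ⊆ A ∧ (0 : ℂ) ∉ F ∧
    ∀ (Φ : ConformalEquiv (upperHalfPlaneSet \ A) upperHalfPlaneSet)
      (Ψ : ∀ n, ConformalEquiv (upperHalfPlaneSet \ J n) upperHalfPlaneSet),
      IsRestrictionMap A Φ → (∀ n, IsRestrictionMap (J n) (Ψ n)) →
      ∀ S ⊆ upperHalfPlaneSet, IsCompact (closure S) → Disjoint (closure S) F →
        TendstoUniformlyOn (fun n z ↦ Ψ n z) (fun z ↦ Φ z) atTop S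

/-- [LSW] Lemma 2.1 (with the Lemma 3.5 convergence) for nonempty `A ∈ 𝒬₊`, packaged with
`F = A ∪ [x₀, x₁]`. [cite: LawlerSchrammWerner2003Restriction, Lemma 2.1 (p. 8)] -/
theorem IsPlusHull.hasArcApprox (h21 : IsPlusHull.exists_antitone_isArcHull) (hA : IsPlusHull A)
    (hne : A.Nonempty) : HasArcApprox A := by
  obtain ⟨J, hJa, hJp, hJm, hJi, hconv⟩ := h21 hA hne
  exact ⟨J, realFill A, hJa, fun n ↦ (hJp n).1, hJm, hJi, subset_realFill A,
    realFill_inter_upperHalfPlaneSet_subset A, hA.zero_notMem_realFill hne,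
    fun Φ Ψ hΦ hΨ ↦ (hconv hΦ hΨ).1⟩

/-- **[LSW] Lemma 2.1 for nonempty `A ∈ 𝒬₋`, by the reflection `σ`** ("by symmetry", as
throughout [LSW] §3): reflect `A` to `σ(A) ∈ 𝒬₊`, approximate, reflect the smooth hulls and the
filling back, and transport the convergence of the restriction maps through
`Φ_{σ(B)} = σ ∘ Φ_B ∘ σ`. [cite: LawlerSchrammWerner2003Restriction, Lemma 2.1 (p. 8) with §2 p. 8 (𝒬₋ = σ(𝒬₊))] -/
theorem IsMinusHull.hasArcApprox (h21 : IsPlusHull.exists_antitone_isArcHull)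
    (hA : IsMinusHull A) (hne : A.Nonempty) : HasArcApprox A := by
  obtain ⟨J, hJa, hJp, hJm, hJi, hconv⟩ := h21 hA.image_imagAxisRefl (hne.image _)
  have hAc : IsClosed A := hA.1.isBoundedHull.isClosed
  have hJc : ∀ n, IsClosed (imagAxisRefl '' J n) := fun n ↦
    (hJp n).1.image_imagAxisRefl.isBoundedHull.isClosed
  set F₀ : Set ℂ := realFill (imagAxisRefl '' A) with hF₀
  refine ⟨fun n ↦ imagAxisRefl '' J n, imagAxisRefl '' F₀, fun n ↦ (hJa n).image_imagAxisRefl,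
    fun n ↦ (hJp n).1.image_imagAxisRefl, fun m n hmn ↦ image_mono (hJm hmn), ?_, ?_, ?_, ?_, ?_⟩
  · rw [← image_iInter imagAxisRefl.bijective, hJi]
  · conv_lhs => rw [← imagAxisRefl_image_image A]
    exact image_mono (subset_realFill _)
  · rintro z ⟨⟨w, hw, rfl⟩, hzH⟩
    have hwH : w ∈ upperHalfPlaneSet := by simpa [upperHalfPlaneSet] using hzH
    have hwA : w ∈ imagAxisRefl '' A := realFill_inter_upperHalfPlaneSet_subset _ ⟨hw, hwH⟩
    rw [← imagAxisRefl_image_image A]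
    exact mem_image_of_mem _ hwA
  · rintro ⟨w, hw, hw0⟩
    have : w = 0 := by simpa using congrArg imagAxisRefl hw0
    rw [this] at hw
    exact (hA.image_imagAxisRefl).zero_notMem_realFill (hne.image _) hw
  · intro Φ Ψ hΦ hΨ S hS hScpt hSF
    -- reflect the maps: restriction maps of `σ(A)` and of `σ(σ(J n)) = J n`
    have hΦ' := hΦ.reflectHull hAc
    have hΨ' := fun n ↦ ((hΨ n).reflectHull (hJc n)).of_eq (imagAxisRefl_image_image (J n))
    have key := (hconv hΦ' hΨ').1 (imagAxisRefl '' S)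
      (by rw [← imagAxisRefl_image_upperHalfPlaneSet]; exact image_mono hS)
      (by rw [← imagAxisRefl.image_closure]; exact hScpt.image imagAxisRefl.continuous)
      (by rw [← imagAxisRefl.image_closure, ← imagAxisRefl_image_image F₀]
          exact (Set.disjoint_image_iff imagAxisRefl.injective).2 hSF)
    refine tendstoUniformlyOn_of_imagAxisRefl ?_
    refine key.congr ?_ |>.congr_right ?_
    · exact Eventually.of_forall fun n ↦ fun z _ ↦ rfl
    · intro z _; rfl

/-- Outer approximation by smooth `*`-hulls, with convergence, for nonempty `A ∈ 𝒬₊ ∪ 𝒬₋`.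
[cite: LawlerSchrammWerner2003Restriction, Lemma 2.1 (p. 8)] -/
theorem hasArcApprox_of_plus_or_minus (h21 : IsPlusHull.exists_antitone_isArcHull)
    (hA : IsPlusHull A ∨ IsMinusHull A) (hne : A.Nonempty) : HasArcApprox A :=
  hA.elim (fun h ↦ IsPlusHull.hasArcApprox h21 h hne) (fun h ↦ IsMinusHull.hasArcApprox h21 h hne)

/-- The members of a family with intersection `B` contain `B`. [folklore] -/
theorem subset_of_iInter_eq {X : Type*} {B : Set X} {J : ℕ → Set X} (hJi : (⋂ n, J n) = B)
    (n : ℕ) : B ⊆ J n :=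
  hJi ▸ iInter_subset J n

variable {X : Type*} [TopologicalSpace X] {B : Set X}

/-- **Eventual avoidance**: a compact set missing `B = ⋂ₙ J n` (decreasing closed `J n`, in a
Hausdorff space) misses `J n` for all large `n`. [folklore] -/
theorem eventually_disjoint_of_iInter_eq [T2Space X] {J : ℕ → Set X} (hJc : ∀ n, IsClosed (J n))
    (hJm : Antitone J) (hJi : (⋂ n, J n) = B) {C : Set X} (hC : IsCompact C)
    (hCA : Disjoint C B) : ∀ᶠ n in atTop, Disjoint C (J n) := by
  have hfam : ∀ n, IsClosed (C ∩ J n) := fun n ↦ hC.isClosed.inter (hJc n)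
  have hempty : (⋂ n, C ∩ J n) = ∅ := by
    rw [← inter_iInter, hJi]
    exact hCA.inter_eq
  obtain ⟨n, hn⟩ : ∃ n, C ∩ J n = ∅ := by
    by_contra h
    push Not at h
    have hdir : Directed (· ⊇ ·) fun n ↦ C ∩ J n := fun m n ↦
      ⟨max m n, inter_subset_inter_right _ (hJm (le_max_left m n)),
        inter_subset_inter_right _ (hJm (le_max_right m n))⟩
    have := IsCompact.nonempty_iInter_of_directed_nonempty_isCompact_isClosed
      (fun n ↦ C ∩ J n) hdir (fun n ↦ h n) (fun n ↦ hC.inter_right (hJc n)) hfam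
    rw [hempty] at this
    exact Set.not_nonempty_empty this
  refine eventually_atTop.2 ⟨n, fun m hm ↦ ?_⟩
  rw [Set.disjoint_iff_inter_eq_empty, ← subset_empty_iff, ← hn]
  exact inter_subset_inter_right _ (hJm hm)

end Approx

/-! ### Non-vacuity: the closed upper half-disc is a smooth `+`-hull -/

section Witness

/-- The closed upper half-disc `{|z - 2| ≤ 1, Im z ≥ 0}`. [folklore] -/
def upperHalfDisc : Set ℂ := closedBall (2 : ℂ) 1 ∩ {z : ℂ | 0 ≤ z.im}

/-- The frontier is local: sets agreeing on an open set have the same frontier there. [folklore] -/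
theorem frontier_inter_eq_of_inter_eq {X : Type*} [TopologicalSpace X] {S S' U : Set X}
    (hU : IsOpen U) (h : S ∩ U = S' ∩ U) : frontier S ∩ U = frontier S' ∩ U := by
  have hcl : ∀ {T T' : Set X}, T ∩ U = T' ∩ U → closure T ∩ U ⊆ closure T' ∩ U := by
    intro T T' hT z ⟨hz, hzU⟩
    refine ⟨?_, hzU⟩
    have h1 : z ∈ closure (T ∩ U) := by
      have := hU.inter_closure (s := U) (t := T) ⟨hzU, hz⟩
      rwa [inter_comm] at this
    rw [hT] at h1
    exact closure_mono inter_subset_left h1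
  have hint : ∀ {T T' : Set X}, T ∩ U = T' ∩ U → interior T ∩ U ⊆ interior T' := by
    intro T T' hT z ⟨hz, hzU⟩
    have h1 : z ∈ interior (T ∩ U) := by
      rw [interior_inter, hU.interior_eq]; exact ⟨hz, hzU⟩
    rw [hT] at h1
    exact interior_mono inter_subset_left h1
  ext z
  simp only [mem_inter_iff, frontier, Set.mem_sdiff]
  constructor
  · rintro ⟨⟨hc, hi⟩, hzU⟩
    exact ⟨⟨(hcl h ⟨hc, hzU⟩).1, fun hi' ↦ hi (hint h.symm ⟨hi', hzU⟩)⟩, hzU⟩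
  · rintro ⟨⟨hc, hi⟩, hzU⟩
    exact ⟨⟨(hcl h.symm ⟨hc, hzU⟩).1, fun hi' ↦ hi (hint h ⟨hi', hzU⟩)⟩, hzU⟩

/-- The part of the frontier of the half-disc in `ℍ` is the open upper semicircle. [folklore] -/
theorem upperHalfPlaneSet_inter_frontier_upperHalfDisc :
    upperHalfPlaneSet ∩ frontier upperHalfDisc = upperHalfPlaneSet ∩ sphere (2 : ℂ) 1 := by
  have h : upperHalfDisc ∩ upperHalfPlaneSet = closedBall (2 : ℂ) 1 ∩ upperHalfPlaneSet := by
    ext z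
    simp only [upperHalfDisc, mem_inter_iff, mem_setOf_eq]
    constructor
    · rintro ⟨⟨hb, -⟩, hz⟩; exact ⟨hb, hz⟩
    · rintro ⟨hb, hz⟩; exact ⟨⟨hb, le_of_lt (show (0 : ℝ) < z.im from hz)⟩, hz⟩
  rw [inter_comm, frontier_inter_eq_of_inter_eq isOpen_upperHalfPlaneSet h,
    frontier_closedBall (2 : ℂ) one_ne_zero, inter_comm]

/-- The arc `t ↦ 2 + e^{iπ(1-t)}` from `1` to `3`. [folklore] -/
def halfDiscArc (t : ℝ) : ℂ := 2 + Complex.exp ((Real.pi * (1 - t) : ℝ) * Complex.I)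

/-- The imaginary part along the arc. [folklore] -/
theorem halfDiscArc_im (t : ℝ) : (halfDiscArc t).im = Real.sin (Real.pi * (1 - t)) := by
  rw [halfDiscArc, Complex.add_im, Complex.exp_ofReal_mul_I_im]
  simp

/-- The arc lies on the circle `|z - 2| = 1`. [folklore] -/
theorem halfDiscArc_mem_sphere (t : ℝ) : halfDiscArc t ∈ sphere (2 : ℂ) 1 := by
  rw [mem_sphere, dist_eq_norm, halfDiscArc, add_sub_cancel_left, Complex.norm_exp_ofReal_mul_I]

/-- **The closed upper half-disc is a smooth hull.** [folklore] -/
theorem isArcHull_upperHalfDisc : IsArcHull upperHalfDisc := by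
  have hDc : IsClosed upperHalfDisc := isClosed_closedBall.inter (isClosed_le continuous_const continuous_im)
  have hDconv : Convex ℝ upperHalfDisc := (convex_closedBall _ _).inter (convex_halfSpace_im_ge 0)
  -- membership in `ℍ ∖ upperHalfDisc`
  have hmemG : ∀ {z : ℂ}, z ∈ upperHalfPlaneSet \ upperHalfDisc ↔ 0 < z.im ∧ 1 < dist z 2 := by
    intro z
    constructor
    · rintro ⟨hz, hzD⟩
      exact ⟨hz, not_le.1 fun h ↦ hzD ⟨mem_closedBall.2 h, le_of_lt (show (0 : ℝ) < z.im from hz)⟩⟩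
    · rintro ⟨hz, h⟩
      exact ⟨hz, fun h' ↦ not_lt.2 (mem_closedBall.1 h'.1) h⟩
  have hcompl : (upperHalfPlaneSet \ upperHalfDisc)ᶜ = upperHalfDisc ∪ {w : ℂ | w.im ≤ 0} := by
    ext w
    rw [mem_compl_iff, Set.mem_sdiff, mem_union]
    constructor
    · intro h
      by_cases hw : 0 < w.im
      · left
        by_contra hwD
        exact h ⟨hw, hwD⟩
      · exact Or.inr (not_lt.1 hw)
    · rintro (h | h) ⟨hw, hwD⟩
      · exact hwD h
      · exact not_lt.2 (show w.im ≤ 0 from h) hw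
  refine ⟨⟨?_, ?_, ?_⟩, halfDiscArc, by unfold halfDiscArc; fun_prop, ?_, ?_, ?_, ?_, ?_⟩
  · exact isBounded_closedBall.subset inter_subset_left
  · -- `closure (D ∩ ℍ) = D`
    refine Subset.antisymm (closure_minimal inter_subset_left hDc) fun z hz ↦ ?_
    rcases (show (0 : ℝ) ≤ z.im from hz.2).lt_or_eq with hpos | hzero
    · exact subset_closure ⟨hz, hpos⟩
    · -- `z` real: approach it along the segment to the interior point `2 + i/2`
      set c : ℂ := 2 + (1 / 2 : ℝ) * Complex.I with hc
      have hcint : c ∈ interior (closedBall (2 : ℂ) 1) := by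
        rw [interior_closedBall (2 : ℂ) one_ne_zero, mem_ball, dist_eq_norm, hc, add_sub_cancel_left,
          norm_mul, Complex.norm_real, Complex.norm_I]
        norm_num
      have hseg : ∀ s : ℝ, 0 < s → s ≤ 1 → s • c + (1 - s) • z ∈ upperHalfDisc ∩ upperHalfPlaneSet := by
        intro s hs hs1
        have h1 : s • c + (1 - s) • z ∈ interior (closedBall (2 : ℂ) 1) :=
          (convex_closedBall (2 : ℂ) 1).combo_interior_closure_mem_interior hcint
            (subset_closure hz.1) hs (by linarith) (by ring)
        rw [interior_closedBall (2 : ℂ) one_ne_zero] at h1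
        have him : (s • c + (1 - s) • z).im = s / 2 := by
          simp [hc, ← hzero]
          ring
        refine ⟨⟨ball_subset_closedBall h1, ?_⟩, ?_⟩
        · show 0 ≤ (s • c + (1 - s) • z).im
          rw [him]; linarith
        · show 0 < (s • c + (1 - s) • z).im
          rw [him]; linarith
      have htend : Tendsto (fun s : ℝ ↦ s • c + (1 - s) • z) (𝓝[>] 0) (𝓝 z) := by
        have h1 : Tendsto (fun s : ℝ ↦ s • c) (𝓝 0) (𝓝 ((0 : ℝ) • c)) :=
          tendsto_id.smul tendsto_const_nhds
        have h2 : Tendsto (fun s : ℝ ↦ (1 - s) • z) (𝓝 0) (𝓝 ((1 - 0 : ℝ) • z)) :=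
          (tendsto_const_nhds.sub tendsto_id).smul tendsto_const_nhds
        have := h1.add h2
        simp only [zero_smul, sub_zero, one_smul, zero_add] at this
        exact this.mono_left nhdsWithin_le_nhds
      refine mem_closure_of_tendsto htend ?_
      filter_upwards [Ioc_mem_nhdsGT (show (0 : ℝ) < 1 by norm_num)] with s hs
      exact hseg s hs.1 hs.2
  · -- simple connectivity of `ℍ ∖ D`
    refine isSimplyConnected_of_isConnected_compl_holds (isOpen_upperHalfPlaneSet.sdiff hDc) ?_ ?_ ?_
    · -- connected: every point sees the region `{Im > 1}` along its vertical ray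
      have hU₂ : {w : ℂ | 1 < w.im} ⊆ upperHalfPlaneSet \ upperHalfDisc := fun w hw ↦ by
        refine hmemG.2 ⟨lt_trans zero_lt_one hw, ?_⟩
        rw [dist_eq_norm]
        have : |(w - 2).im| ≤ ‖w - 2‖ := Complex.abs_im_le_norm _
        rw [sub_im, show (2 : ℂ).im = 0 by simp, sub_zero] at this
        exact lt_of_lt_of_le (lt_of_lt_of_le hw (le_abs_self _)) this
      have hray : ∀ {z : ℂ}, z ∈ upperHalfPlaneSet \ upperHalfDisc → upRay z ⊆ upperHalfPlaneSet \ upperHalfDisc := by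
        intro z hz w hw
        obtain ⟨hre, him⟩ := mem_upRay_iff.1 hw
        obtain ⟨hz0, hzd⟩ := hmemG.1 hz
        refine hmemG.2 ⟨hz0.trans_le him, ?_⟩
        rw [dist_eq_norm] at hzd ⊢
        have h1 : ‖z - 2‖ ^ 2 ≤ ‖w - 2‖ ^ 2 := by
          rw [Complex.sq_norm, Complex.sq_norm, Complex.normSq_apply, Complex.normSq_apply]
          simp only [sub_re, sub_im, show (2 : ℂ).re = 2 by simp, show (2 : ℂ).im = 0 by simp, sub_zero, hre]
          nlinarith [hz0, him]
        nlinarith [norm_nonneg (z - 2), norm_nonneg (w - 2)]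
      refine ⟨⟨2 + 2 * Complex.I, hU₂ (by simp)⟩, isPreconnected_of_forall (2 + 2 * Complex.I) fun z hz ↦ ?_⟩
      obtain ⟨hz0, -⟩ := hmemG.1 hz
      refine ⟨upRay z ∪ {w : ℂ | 1 < w.im}, union_subset (hray hz) hU₂, Or.inr (by simp),
        Or.inl (self_mem_upRay z), ?_⟩
      -- the ray meets `{Im > 1}` at `z + 2i`
      refine IsPreconnected.union (z + ((z.im + 2 : ℝ) : ℂ) * Complex.I - z.im * Complex.I) ?_ ?_
        (isConnected_upRay z).isPreconnected (convex_halfSpace_im_gt 1).isPreconnected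
      · rw [mem_upRay_iff]
        constructor
        · simp
        · simp
      · show 1 < (z + ((z.im + 2 : ℝ) : ℂ) * Complex.I - z.im * Complex.I).im
        simp
        linarith
    · -- the complement `D ∪ {Im ≤ 0}` is connected
      rw [hcompl]
      refine ⟨⟨2, Or.inr (by simp)⟩, ?_⟩
      refine IsPreconnected.union (2 : ℂ) ?_ (by simp) hDconv.isPreconnected
        (convex_halfSpace_im_le 0).isPreconnected
      exact ⟨by rw [mem_closedBall, dist_self]; norm_num, by simp⟩
    · -- ... and unbounded
      intro hb
      rw [hcompl] at hb
      obtain ⟨R, hR⟩ := (hb.subset subset_union_right).subset_closedBall 0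
      have := hR (show -(((|R| + 1 : ℝ) : ℂ) * Complex.I) ∈ {w : ℂ | w.im ≤ 0} by
        show (-(((|R| + 1 : ℝ) : ℂ) * Complex.I)).im ≤ 0
        rw [show (-(((|R| + 1 : ℝ) : ℂ) * Complex.I)).im = -(|R| + 1) by simp]
        linarith [abs_nonneg R])
      rw [mem_closedBall, dist_zero_right, norm_neg, norm_mul, Complex.norm_real, Complex.norm_I,
        mul_one, Real.norm_eq_abs, abs_of_pos (by positivity)] at this
      linarith [le_abs_self R]
  · -- injectivity of the arc on `[0, 1]`
    intro s hs t ht hst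
    have h1 : Complex.exp ((Real.pi * (1 - s) : ℝ) * Complex.I) = Complex.exp ((Real.pi * (1 - t) : ℝ) * Complex.I) := by
      simpa [halfDiscArc] using hst
    obtain ⟨n, hn⟩ := Complex.exp_eq_exp_iff_exists_int.1 h1
    have hn' : Real.pi * (1 - s) = Real.pi * (1 - t) + n * (2 * Real.pi) := by
      have := congrArg Complex.im hn
      simpa using this
    have hts : t - s = 2 * n := by
      have hpi : Real.pi ≠ 0 := Real.pi_ne_zero
      have : Real.pi * (t - s) = Real.pi * (2 * n) := by linarith
      exact mul_left_cancel₀ hpi this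
    have hn0 : n = 0 := by
      have h2 : |(2 * n : ℝ)| ≤ 1 := by
        rw [← hts, abs_sub_le_iff]
        exact ⟨by linarith [hs.1, ht.2], by linarith [hs.2, ht.1]⟩
      have h3 : |(n : ℝ)| < 1 := by
        rw [abs_mul] at h2
        norm_num at h2
        linarith [abs_nonneg (n : ℝ)]
      exact Int.abs_lt_one_iff.1 (by exact_mod_cast h3)
    rw [hn0] at hts
    simp at hts
    linarith
  · -- endpoints and interior
    rw [halfDiscArc_im]; simp
  · rw [halfDiscArc_im]; simp
  · intro t ht
    rw [halfDiscArc_im]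
    exact Real.sin_pos_of_pos_of_lt_pi (by nlinarith [Real.pi_pos, ht.2]) (by nlinarith [Real.pi_pos, ht.1])
  · -- `ℍ ∩ ∂D` is the open semicircle
    rw [upperHalfPlaneSet_inter_frontier_upperHalfDisc]
    ext w
    constructor
    · rintro ⟨hw, hws⟩
      have hw0 : (0 : ℝ) < w.im := hw
      rw [mem_sphere, dist_eq_norm] at hws
      have hwim : (w - 2).im = w.im := by simp
      have hθ0 : 0 < Complex.arg (w - 2) := by
        rcases (Complex.arg_nonneg_iff.2 (by rw [hwim]; exact hw0.le)).lt_or_eq with h | h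
        · exact h
        · exfalso
          have := (Complex.arg_eq_zero_iff.1 h.symm).2
          rw [hwim] at this
          linarith
      have hθπ : Complex.arg (w - 2) < Real.pi :=
        Complex.arg_lt_pi_iff.2 (Or.inr (by rw [hwim]; exact hw0.ne'))
      refine ⟨1 - Complex.arg (w - 2) / Real.pi, ⟨by
        rw [sub_pos, div_lt_one Real.pi_pos]; exact hθπ, by
        have : 0 < Complex.arg (w - 2) / Real.pi := div_pos hθ0 Real.pi_pos
        linarith⟩, ?_⟩
      have hexp := Complex.norm_mul_exp_arg_mul_I (w - 2)
      rw [hws, Complex.ofReal_one, one_mul] at hexp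
      rw [halfDiscArc, show Real.pi * (1 - (1 - Complex.arg (w - 2) / Real.pi)) = Complex.arg (w - 2) by
        field_simp; ring, hexp]
      ring
    · rintro ⟨t, ht, rfl⟩
      refine ⟨?_, halfDiscArc_mem_sphere t⟩
      show 0 < (halfDiscArc t).im
      rw [halfDiscArc_im]
      exact Real.sin_pos_of_pos_of_lt_pi (by nlinarith [Real.pi_pos, ht.2]) (by nlinarith [Real.pi_pos, ht.1])

/-- **The closed upper half-disc is a smooth `+`-hull** (non-vacuity of `IsArcHull` and of the
hypotheses of `IsPlusHull.exists_antitone_isArcHull`). [folklore] -/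
theorem isPlusHull_upperHalfDisc : IsPlusHull upperHalfDisc := by
  refine ⟨⟨isArcHull_upperHalfDisc.1, fun h ↦ ?_⟩, fun x hx ↦ ?_⟩
  · have := h.1
    rw [mem_closedBall, dist_eq_norm, zero_sub, norm_neg] at this
    norm_num at this
  · have h1 := hx.1
    rw [mem_closedBall, dist_eq_norm, show (x : ℂ) - 2 = ((x - 2 : ℝ) : ℂ) by push_cast; ring,
      Complex.norm_real, Real.norm_eq_abs, abs_le] at h1
    linarith [h1.1]

/-- The half-disc is nonempty. [folklore] -/
theorem upperHalfDisc_nonempty : upperHalfDisc.Nonempty :=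
  ⟨2, by rw [upperHalfDisc, mem_inter_iff, mem_closedBall, dist_self]; exact ⟨zero_le_one, by simp⟩⟩

end Witness

end Literature.Probability.RandomPlanarGeometry

end
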